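import Summits.BirchSwinnertonDyer.Rank1Residual.Additive.GordManinConstantTwistDegree
import HarnessLib

/-!
# X3/X4 at an additive prime: class-X4 CONSUMERS of the twist-degree Manin binder for the STARRED
# potentially good types (Kim 2026 rank `0`; both ranks from the lower halves) at EVERY `p ≥ 5`

HONEST FRAMING (cell `b2b-bsdres`, run/shared/lean/b2b/bsd-rank1-residual/, verbatim in every
file): the goal of the cell is to DELETE the COMBINATION-SHAPED residual classes of the
Birch–Swinnerton-Dyer formula for ALL analytic-rank `≤ 1` elliptic curves over `ℚ` — "full BSD
formula for every rank `≤ 1` curve in class `C`" assembled STRICTLY from published theorems — so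
that the rank-`≤ 1` remainder becomes exactly the CONSTRUCTION-SHAPED classes, which are TYPED
(missing-input `Prop`s), NOT attempted. This is not "finishing BSD". Sub-cell `additive-p2`
(CLASS-OWNERS row "X3/X4 additive — pot. good ordinary / X3♯(G-ord)"), generation 17: research
route; no claim beyond the stated classes; theorems only, no definition, no new named fact (published
binders as hypotheses: `hCNS` = A159, `hKim`, `hGZ`, `hKo`, `hB`, `hGZK`, `hmod`, `hnf`, `hFH`);
X3♯(G-ord)/X4♯(G-ord) stay CONSTRUCTION-SHAPED; no label moves; nothing is booked.

WHAT THIS FILE DOES. `GordManinConstantTwistDegree.lean` §2 proved the Manin datum of a STARRED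
additive potentially good pair `(W, p)` (`6 < ord_p Δ_min(W)`; Kodaira IV* / III* / II*) at EVERY
`p ≥ 5` from two class integers: `p² ∤ deg(D♭)` for a conductor-level datum `D♭` of `W`, and
`p ∤ deg(D)` for a conductor-level datum `D` of ANY globally minimal model `V` of the twist
`E ⊗ χ_{p*}` (`C • V^{(p*)} = W`) — `Addv.not_dvd_maninConstant_of_twistDegrees` (Zagier +
Rankin–Selberg + Česnavičius–Neururer–Saha; no optimality, no Edixhoven). This file threads that
datum through the cell's class-X4 consumers exactly as gen 16 did with `p ∤ deg(D)`
(`GordManinConstantDegree.lean` §2–§3): Kim's rank-`0` upper half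
(`ClassX4.missingUpperBoundAt_rankZero_of_twistDegrees`), `BSD(E,p)` on the `p ∤ #Ш_an` rows
(`ClassX4.bsdp_rankZero_of_twistDegrees_of_shaAn_unit`), BOTH ranks from the LOWER halves of the
same-`j` X4 pairs (`ClassX4.bsdp_of_twistDegrees_of_lowerHalves`, additive-p1's
`AdditivePotMult.bsdp_of_classX4_of_lowerHalves`), and the reading on X4♯(G-ord)
(`ClassX4Gord.bsdp_of_twistDegrees_of_lowerHalves`: starred defects 3, 4, 6 at `p ∈ {5, 7}`
included — the R12 residual of AUDIT-X34-GORD). Census `HOME/b2b-bsdres-additive-p2/census/gen17/`: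
on the starred (G-ord) X4 rows at `p ∈ {5, 7}`, `N > 130 000`, `r = 0`, binder-complete
(`ρ̄` onto, `p ∤ ∏c_ℓ`, `p ∤ #Ш_an`): `12 795` of `17 843` pairs move database (`c = 1`) → theorem +
two degrees. The located gap (the LOWER half) is untouched: labels UNCHANGED; nothing booked.

References: K. Česnavičius, M. Neururer, A. Saha, J. Eur. Math. Soc. 26 (2024) Thm. 1.2
[CesnaviciusNeururerSaha2023]; C.-H. Kim, Amer. J. Math. 148 (2026) Thm. 1.8
[Kim2022StructureSelmer]; W. G. McCallum, in *L-functions and Arithmetic* (1991) §1 (Kolyvagin)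
[McCallumLMS1991]; D. Zagier, Canad. Math. Bull. 28 (1985) §1 [ZagierCMB1985].
-/

noncomputable section

open scoped Classical NumberField

open WeierstrassCurve IsDedekindDomain IsDedekindDomain.HeightOneSpectrum NumberField
  Rat.HeightOneSpectrum Literature.NumberTheory.EllipticCurves
  Literature.NumberTheory.EllipticCurves.ModularForms
  Literature.NumberTheory.EllipticCurves.Rank1Residual
  Literature.NumberTheory.EllipticCurves.Rank1Residual.Typed
  Literature.NumberTheory.DiophantineGeometry

namespace Summit.BirchSwinnertonDyer.Rank1Residual.Additive

variable (p : ℕ) [hp : Fact p.Prime]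

/-! ### Consumers on class X4 for the STARRED member: Manin datum from two degrees -/

/-- **X4 ∧ `r = 0`, `p ≥ 5`, `ρ̄` onto, `p ∤ ∏ c_ℓ`, STARRED additive potentially good `W`
(`6 < ord_p Δ_min`, `0 ≤ ord_p j`) with a conductor-level datum `D♭`, `p² ∤ deg(D♭)`, and a
degree-free conductor-level datum `D` of a minimal model `V` of the `p*`-twist: the typed UPPER half
`MissingUpperBoundAt W p`** (Kim 2026 Thm. 1.8 (6) via `X4RankZero.missingUpperBoundAt`, Manin datum
from `Addv.not_dvd_maninConstant_of_twistDegrees`). [cite: Kim2022StructureSelmer, Thm. 1.9 (6) (PDF p. 8)]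
[cite: CesnaviciusNeururerSaha2023, Thm. 1.2] -/
theorem ClassX4.missingUpperBoundAt_rankZero_of_twistDegrees
    (hKim : Kim2026.rankZero_padicValNat_sha_le_of_maninConstant)
    (hGZK : rank_eq_analyticRank_of_analyticRank_le_one) (hmod : hasEntireLFunction_rat)
    (hCNS : cesnaviciusNeururerSaha_padicVal_maninConstant_le_modularDegree)
    (W : WeierstrassCurve ℚ) [W.IsElliptic] [W.IsGloballyMinimal]
    (hp5 : 5 ≤ p) (hr : W.analyticRank = 0) (hX : ClassX4 W p) (hsurj : Surj W p)
    (hjW : 0 ≤ padicValRat p W.j) (h6 : 6 < padicValInt p W.minimalDiscriminantInt)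
    [NeZero (W.conductorNorm ℤ)] (D' : ModularParametrizationData W (W.conductorNorm ℤ))
    (hdeg' : ¬ p ^ 2 ∣ D'.modularDegree) (htam : ¬ p ∣ W.tamagawaProduct)
    (V : WeierstrassCurve ℚ) [V.IsElliptic] [V.IsGloballyMinimal] [NeZero (V.conductorNorm ℤ)]
    (C : VariableChange ℚ) (hC : C • V.quadraticTwist ((-1 : ℚ) ^ (p / 2) * p) = W)
    (D : ModularParametrizationData V (V.conductorNorm ℤ)) (hdeg : ¬ p ∣ D.modularDegree) :
    MissingUpperBoundAt W p :=
  X4RankZero.missingUpperBoundAt W p hKim hGZK hmod hp5 hr hX hsurj D'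
    (Addv.not_dvd_maninConstant_of_twistDegrees p hCNS hp5 W hX.2.1 hjW h6 D' hdeg' V C hC D hdeg) htam

/-- **`BSD(E,p)` on X4 ∧ `r = 0` at `p ≥ 5` for the STARRED member when `#Ш_an` and `∏ c_ℓ` are
`p`-units, `ρ̄` onto — Manin datum from the two degrees** (`p² ∤ deg(D♭)`, `p ∤ deg(D)`), NO
optimality. [cite: Kim2022StructureSelmer, Thm. 1.9 (6) (PDF p. 8)] [cite: Miller2011LMS, Def. 1.1]
[cite: CesnaviciusNeururerSaha2023, Thm. 1.2] -/
theorem ClassX4.bsdp_rankZero_of_twistDegrees_of_shaAn_unit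
    (hKim : Kim2026.rankZero_padicValNat_sha_le_of_maninConstant)
    (hGZK : rank_eq_analyticRank_of_analyticRank_le_one) (hmod : hasEntireLFunction_rat)
    (hCNS : cesnaviciusNeururerSaha_padicVal_maninConstant_le_modularDegree)
    (W : WeierstrassCurve ℚ) [W.IsElliptic] [W.IsGloballyMinimal]
    (hp5 : 5 ≤ p) (hr : W.analyticRank = 0) (hX : ClassX4 W p) (hsurj : Surj W p)
    (hjW : 0 ≤ padicValRat p W.j) (h6 : 6 < padicValInt p W.minimalDiscriminantInt)
    [NeZero (W.conductorNorm ℤ)] (D' : ModularParametrizationData W (W.conductorNorm ℤ))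
    (hdeg' : ¬ p ^ 2 ∣ D'.modularDegree) (htam : ¬ p ∣ W.tamagawaProduct)
    (V : WeierstrassCurve ℚ) [V.IsElliptic] [V.IsGloballyMinimal] [NeZero (V.conductorNorm ℤ)]
    (C : VariableChange ℚ) (hC : C • V.quadraticTwist ((-1 : ℚ) ^ (p / 2) * p) = W)
    (D : ModularParametrizationData V (V.conductorNorm ℤ)) (hdeg : ¬ p ∣ D.modularDegree)
    {q : ℚ} (hq : shaAn W = (q : ℂ)) (hv : padicValRat p q = 0) : BSDp W p :=
  X4RankZero.bsdp_of_shaAn_unit W p hKim hGZK hmod hp5 hr hX hsurj D'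
    (Addv.not_dvd_maninConstant_of_twistDegrees p hCNS hp5 W hX.2.1 hjW h6 D' hdeg' V C hC D hdeg)
    htam hq hv

/-- **X4, BOTH analytic ranks, EVERY `p ≥ 5`, `ρ̄` onto, `p ∤ ∏ c_ℓ`, STARRED additive potentially
good member `W` with the two-degree certificate (`p² ∤ deg(D♭)`, `p ∤ deg(D)` on a minimal model of
the twist): `BSD(E,p)` from the LOWER halves of the same-`j` X4 pairs alone** — additive-p1's
`AdditivePotMult.bsdp_of_classX4_of_lowerHalves` (Kim in rank `0`, Kolyvagin + Gross–Zagier in rank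
`1`) with the Manin datum from `Addv.not_dvd_maninConstant_of_twistDegrees`. Published binders only.
[cite: CesnaviciusNeururerSaha2023, Thm. 1.2] [cite: Kim2022StructureSelmer, Thm. 1.9 (6) (PDF p. 8)]
[cite: McCallumLMS1991, §1 Theorem (Kolyvagin), p. 296] -/
theorem ClassX4.bsdp_of_twistDegrees_of_lowerHalves
    (hKim : Kim2026.rankZero_padicValNat_sha_le_of_maninConstant)
    (hGZ : ∀ (N : ℕ) [NeZero N] (W : WeierstrassCurve ℚ) (K : Type) [Field K] [NumberField K],
      gross_zagier N W K)
    (hKo : ∀ (N : ℕ) [NeZero N] (W : WeierstrassCurve ℚ) (K : Type) [Field K] [NumberField K],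
      kolyvagin N W K)
    (hB : ∀ (N : ℕ) [NeZero N] (W : WeierstrassCurve ℚ) (K : Type) [Field K] [NumberField K],
      Kolyvagin1990_padicValNat_card_sha_le N W K)
    (hGZK : rank_eq_analyticRank_of_analyticRank_le_one) (hmod : hasEntireLFunction_rat)
    (hnf : exists_isNewformOf) (hFH : friedbergHoffstein_exists_heegnerField_split_twist_ne_zero)
    (hCNS : cesnaviciusNeururerSaha_padicVal_maninConstant_le_modularDegree)
    (W : WeierstrassCurve ℚ) [W.IsElliptic] [W.IsGloballyMinimal] [NeZero (W.conductorNorm ℤ)]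
    (hX : ClassX4 W p) (hr : W.analyticRank ≤ 1) (hsurj : Surj W p) (hp5 : 5 ≤ p)
    (hjW : 0 ≤ padicValRat p W.j) (h6 : 6 < padicValInt p W.minimalDiscriminantInt)
    (D' : ModularParametrizationData W (W.conductorNorm ℤ)) (hdeg' : ¬ p ^ 2 ∣ D'.modularDegree)
    (htam : ¬ p ∣ W.tamagawaProduct)
    (V : WeierstrassCurve ℚ) [V.IsElliptic] [V.IsGloballyMinimal] [NeZero (V.conductorNorm ℤ)]
    (C : VariableChange ℚ) (hC : C • V.quadraticTwist ((-1 : ℚ) ^ (p / 2) * p) = W)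
    (D : ModularParametrizationData V (V.conductorNorm ℤ)) (hdeg : ¬ p ∣ D.modularDegree)
    (hlow : ∀ (V' : WeierstrassCurve ℚ) [V'.IsElliptic] [V'.IsGloballyMinimal], ClassX4 V' p →
      V'.j = W.j → V'.analyticRank ≤ 1 → MissingLowerBoundAt V' p) :
    BSDp W p :=
  AdditivePotMult.bsdp_of_classX4_of_lowerHalves hKim hGZ hKo hB hGZK hmod hnf hFH hX hr hsurj hp5 D'
    (Addv.not_dvd_maninConstant_of_twistDegrees p hCNS hp5 W hX.2.1 hjW h6 D' hdeg' V C hC D hdeg)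
    htam hlow

/-- **Reading on X4♯(G-ord), STARRED types (IV*, III*, II* — defects 3, 4, 6 starred), BOTH ranks,
EVERY `p ≥ 5` (so `p ∈ {5, 7}`, where Edixhoven is silent and `p ∣ deg` always): `BSD(E,p)` from
the LOWER halves of the same-`j` X4 pairs, given `ρ̄` onto, `p ∤ ∏ c_ℓ`, `p² ∤ deg(D♭)` and a
degree-free datum on a minimal model of the `p*`-twist** (`0 ≤ ord_p j` is automatic from (G),
`padicValRat_j_nonneg_of_typeGOrd`). Labels UNCHANGED (the lower half is the located gap).
[cite: CesnaviciusNeururerSaha2023, Thm. 1.2] [cite: Kim2022StructureSelmer, Thm. 1.9 (6) (PDF p. 8)] -/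
theorem ClassX4Gord.bsdp_of_twistDegrees_of_lowerHalves
    (hKim : Kim2026.rankZero_padicValNat_sha_le_of_maninConstant)
    (hGZ : ∀ (N : ℕ) [NeZero N] (W : WeierstrassCurve ℚ) (K : Type) [Field K] [NumberField K],
      gross_zagier N W K)
    (hKo : ∀ (N : ℕ) [NeZero N] (W : WeierstrassCurve ℚ) (K : Type) [Field K] [NumberField K],
      kolyvagin N W K)
    (hB : ∀ (N : ℕ) [NeZero N] (W : WeierstrassCurve ℚ) (K : Type) [Field K] [NumberField K],
      Kolyvagin1990_padicValNat_card_sha_le N W K)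
    (hGZK : rank_eq_analyticRank_of_analyticRank_le_one) (hmod : hasEntireLFunction_rat)
    (hnf : exists_isNewformOf) (hFH : friedbergHoffstein_exists_heegnerField_split_twist_ne_zero)
    (hCNS : cesnaviciusNeururerSaha_padicVal_maninConstant_le_modularDegree)
    (W : WeierstrassCurve ℚ) [W.IsElliptic] [W.IsGloballyMinimal] [NeZero (W.conductorNorm ℤ)]
    (hX : ClassX4Gord W p) (hr : W.analyticRank ≤ 1) (hsurj : Surj W p) (hp5 : 5 ≤ p)
    (h6 : 6 < padicValInt p W.minimalDiscriminantInt)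
    (D' : ModularParametrizationData W (W.conductorNorm ℤ)) (hdeg' : ¬ p ^ 2 ∣ D'.modularDegree)
    (htam : ¬ p ∣ W.tamagawaProduct)
    (V : WeierstrassCurve ℚ) [V.IsElliptic] [V.IsGloballyMinimal] [NeZero (V.conductorNorm ℤ)]
    (C : VariableChange ℚ) (hC : C • V.quadraticTwist ((-1 : ℚ) ^ (p / 2) * p) = W)
    (D : ModularParametrizationData V (V.conductorNorm ℤ)) (hdeg : ¬ p ∣ D.modularDegree)
    (hlow : ∀ (V' : WeierstrassCurve ℚ) [V'.IsElliptic] [V'.IsGloballyMinimal], ClassX4 V' p →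
      V'.j = W.j → V'.analyticRank ≤ 1 → MissingLowerBoundAt V' p) :
    BSDp W p :=
  ClassX4.bsdp_of_twistDegrees_of_lowerHalves p hKim hGZ hKo hB hGZK hmod hnf hFH hCNS W hX.1 hr hsurj
    hp5 (padicValRat_j_nonneg_of_typeGOrd W p hX.typeGOrd) h6 D' hdeg' htam V C hC D hdeg hlow

end Summit.BirchSwinnertonDyer.Rank1Residual.Additive

end
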